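import Literature.NumberTheory.EllipticCurves.IwasawaSelmer
import Literature.NumberTheory.EllipticCurves.PAdicBSD
import Literature.NumberTheory.EllipticCurves.KatoDivisibilityIntegralSkeletonProofs
import Literature.NumberTheory.EllipticCurves.SkinnerUrban2014.CharacteristicIdealBaseChangeProofs
import Literature.NumberTheory.EllipticCurves.IwasawaAlgebraRankOneIdealProofs
import Literature.NumberTheory.EllipticCurves.IwasawaAlgebraCharIdealProofs
import Literature.NumberTheory.EllipticCurves.IwasawaAlgebraProofs
import Summits.BirchSwinnertonDyer.BirchSwinnertonDyer.Theorems.PrintX9KatoZetaImageLocalized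
import HarnessLib

/-!
# `Λ`-algebra for the (A)-road at a multiplicative prime: lengths at height-one primes of `Λ = ℤ_p⟦T⟧` and the
# ABSORPTION of a power of `p` into `char_Λ X` under a `μ`-INEQUALITY (lines «finemu5» ∕ «finemu3» of the cruxes
# `PrintX11a.UpperNonSurjFive` stmt-BirchSwinnertonDyer-20614 ∕ `…Three` …-20613; part 1 of the TRANSFER stub)

Seat `bsd-line-x11a-p3` (lead of line finemu5, D-0154 KEY (147)(e)); helper `--supports stmt-BirchSwinnertonDyer-20614`.
Theorems only (pure commutative algebra over `Λ` and over a Selmer dual datum); no definition, no named fact, no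
`sorry`; nothing is asserted about any curve; BSD is not proved by any of this.

WHAT.  The `μ`-road's absorption lemmas (`X11b.mem_charIdeal_of_C_pow_mul_mem_of_mu_eq_zero`,
`X11b.mem_charIdeal_of_katoRat_of_integral_of_mu_eq_zero[_split]`, cell bsd-stepL) turn the `⊗ℚ` Kato shape
`g ∈ char_Λ X`, `ι g = p^n · L` plus the integrality `ι G = ϖ · L` into `G ∈ char_Λ X` using `μ(X) = 0`.  On the
(A)-road (Coates–Sujatha's statement (A) in place of the analytic `μ = 0`) one only has the INEQUALITY
`ℓ_(p)(X) ≤ ℓ_(p)(Λ/(G))` (Kato §17.13 bookkeeping with `μ(X₀) = 0`); this file proves the absorption under that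
inequality, prime by prime at the height-one primes of `Λ` (`Module.mem_charIdeal_of_lengthAt_le`):

* §1 `lengthAt_le_quotient_span_of_mem_charIdeal` (`g ∈ char X ⟹ ℓ_𝔭(X) ≤ ℓ_𝔭(Λ/(g))`),
  `lengthAt_quotient_span_C_pow_mul_offP` (off `(p)` a power of `p` is invisible), the absorption
  `mem_charIdeal_of_span_eq_of_lengthAt_le` (`g ∈ char X`, `(p^a·g) = (p^N·G)`, `ℓ_(p)(X) ≤ ℓ_(p)(Λ/(G))` ⟹
  `G ∈ char X`), `T ∉ (p)`, and the rational-period-ratio bookkeeping `C(ϖ.num)·y = p^{n+e}·C(b')·G`;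
* §1b the two shapes over a Selmer dual datum: `mem_charIdeal_of_katoRat_of_integral_of_lengthAt_le` (non-split:
  `ι g = p^n·L`, `ι G = ϖ·L`) and `exists_mem_charIdeal_of_katoRat_of_integral_of_lengthAt_le_split` (split:
  `ι(T·g) = p^n·L` ⟹ `G = T·G'`, `G' ∈ char X`).

Part 2 (`Theorems/PrintX11aFineMuTransferMult.lean`) feeds the inequality from Kato's §17.13 package at `p ∥ N` and
statement (A), and proves the registered stub `stub_multDivisibilityAt_of_conjA`.

References: [Washington1997] §13.1–13.2; [Kato2004Asterisque] Thm. 17.4 (2)–(3) (p. 273), §17.13 (pp. 279–280);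
[SkinnerUrban2014] §3.1.6; [Kobayashi2006DocMath] Thm. 4.1 (split shape); tree: `IwasawaAlgebra{CharIdeal,Divisibility,RankOneIdeal}Proofs.lean`,
`KatoDivisibilityIntegralSkeletonProofs.lean`, `SkinnerUrban2014/CharacteristicIdealBaseChangeProofs.lean`,
`Theorems/ErratumRoadFiveNonSurjCornerTwin{Mu,Rubin,KatoRat}.lean` (the `μ = 0` twins).
-/

set_option autoImplicit false

noncomputable section

open scoped Classical
open Literature.NumberTheory.EllipticCurves
open Summit.BirchSwinnertonDyer.BirchSwinnertonDyer.Rank1Residual (ZetaImage.eq_augIdealP_of_height_eq_one_of_C_mem ZetaImage.X_notMem_augIdealP)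

namespace Summit.BirchSwinnertonDyer.Rank1Residual.X11b.FineMuTransfer

open Module IwasawaAlgebra

/-! ### §1 `Λ`-algebra: lengths at height-one primes and the absorption lemma with a `μ`-inequality -/

section Algebra

variable {p : ℕ} [Fact p.Prime]

/-- **`g ∈ char_Λ X` ⟹ `ℓ_𝔭(X) ≤ ℓ_𝔭(Λ/(g))` at every height-one prime** (`X` finitely generated torsion,
`g ≠ 0`): `char(Λ/(g)) = (g) ⊆ char X` and the characteristic ideal determines the local lengths
(`SkinnerUrban2014.lengthAt_le_of_charIdeal_le`). [cite: Washington1997, §13.2] [cite: SkinnerUrban2014, §3.1.6 (p. 20)] -/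
theorem lengthAt_le_quotient_span_of_mem_charIdeal {X : Type*} [AddCommGroup X]
    [Module (IwasawaAlgebra p) X] [Module.Finite (IwasawaAlgebra p) X]
    (hX : Module.IsTorsion (IwasawaAlgebra p) X) {g : IwasawaAlgebra p} (hg0 : g ≠ 0)
    (hg : g ∈ charIdeal (IwasawaAlgebra p) X) (𝔭 : PrimeSpectrum (IwasawaAlgebra p))
    (h𝔭 : 𝔭.asIdeal.height = 1) :
    lengthAt (IwasawaAlgebra p) X 𝔭 ≤ lengthAt (IwasawaAlgebra p) (IwasawaAlgebra p ⧸ Ideal.span {g}) 𝔭 := by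
  -- `Λ/(g)` is torsion (killed by `g ≠ 0`)
  have htors : Module.IsTorsion (IwasawaAlgebra p) (IwasawaAlgebra p ⧸ Ideal.span {g}) := by
    intro x
    refine ⟨⟨g, mem_nonZeroDivisors_of_ne_zero hg0⟩, ?_⟩
    obtain ⟨y, rfl⟩ := Ideal.Quotient.mk_surjective x
    change g • Ideal.Quotient.mk (Ideal.span {g}) y = 0
    rw [← Ideal.Quotient.mk_eq_mk, ← Submodule.Quotient.mk_smul, Submodule.Quotient.mk_eq_zero,
      smul_eq_mul]
    exact Ideal.mul_mem_right _ _ (Ideal.mem_span_singleton_self g)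
  refine SkinnerUrban2014.lengthAt_le_of_charIdeal_le htors hX ?_ 𝔭 h𝔭
  rw [charIdeal_quotient_span_singleton hg0, Ideal.span_singleton_le_iff_mem]
  exact hg

/-- Off `(p)`: `ℓ_𝔭(Λ/(p^a · x)) = ℓ_𝔭(Λ/(x))` for a height-one prime `𝔭 ∌ p`. [cite: Washington1997, §13.2] -/
theorem lengthAt_quotient_span_C_pow_mul_offP (x : IwasawaAlgebra p) (a : ℕ)
    (𝔭 : PrimeSpectrum (IwasawaAlgebra p)) (h𝔭 : 𝔭.asIdeal.height = 1)
    (hp𝔭 : PowerSeries.C (p : ℤ_[p]) ∉ 𝔭.asIdeal) :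
    lengthAt (IwasawaAlgebra p) (IwasawaAlgebra p ⧸ Ideal.span {PowerSeries.C (p : ℤ_[p]) ^ a * x}) 𝔭 =
      lengthAt (IwasawaAlgebra p) (IwasawaAlgebra p ⧸ Ideal.span {x}) 𝔭 := by
  rw [lengthAt_quotient_span_singleton_mul x (pow_ne_zero a (prime_C p).ne_zero) 𝔭,
    lengthAt_quotient_span_singleton_pow (prime_C p).ne_zero a 𝔭,
    lengthAt_quotient_span_singleton (prime_C p) 𝔭 h𝔭, if_neg hp𝔭, nsmul_zero, zero_add]

/-- **Absorption with a `μ`-INEQUALITY** (replaces the `μ = 0` of `X11b.mem_charIdeal_of_C_pow_mul_mem_of_mu_eq_zero`).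
For a finitely generated torsion `Λ`-module `X`: if `g ∈ char_Λ X`, the ideals `(p^a · g)` and `(p^N · G)` coincide,
and `ℓ_(p)(X) ≤ ℓ_(p)(Λ/(G))`, then `G ∈ char_Λ X`.  Proof prime by prime (`Module.mem_charIdeal_of_lengthAt_le`):
at `𝔭 = (p)` the hypothesis; at `𝔭 ∌ p`, `ℓ_𝔭(X) ≤ ℓ_𝔭(Λ/(g)) = ℓ_𝔭(Λ/(p^a g)) = ℓ_𝔭(Λ/(p^N G)) = ℓ_𝔭(Λ/(G))`.
[cite: Washington1997, §13.2] [cite: Kato2004Asterisque, Thm. 17.4 (2)–(3) (p. 273) (lengths at height-one primes)] -/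
theorem mem_charIdeal_of_span_eq_of_lengthAt_le {X : Type*} [AddCommGroup X]
    [Module (IwasawaAlgebra p) X] [Module.Finite (IwasawaAlgebra p) X]
    (hX : Module.IsTorsion (IwasawaAlgebra p) X) {g G : IwasawaAlgebra p} {a N : ℕ}
    (hg : g ∈ charIdeal (IwasawaAlgebra p) X)
    (hrel : Ideal.span {PowerSeries.C (p : ℤ_[p]) ^ a * g} = Ideal.span {PowerSeries.C (p : ℤ_[p]) ^ N * G})
    (hμ : ∀ 𝔭 : PrimeSpectrum (IwasawaAlgebra p), 𝔭.asIdeal = augIdealP p →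
      lengthAt (IwasawaAlgebra p) X 𝔭 ≤ lengthAt (IwasawaAlgebra p) (IwasawaAlgebra p ⧸ Ideal.span {G}) 𝔭) :
    G ∈ charIdeal (IwasawaAlgebra p) X := by
  by_cases hG0 : G = 0
  · rw [hG0]; exact zero_mem _
  have hg0 : g ≠ 0 := by
    rintro rfl
    have h : PowerSeries.C (p : ℤ_[p]) ^ N * G ∈ Ideal.span {PowerSeries.C (p : ℤ_[p]) ^ a * (0 : IwasawaAlgebra p)} :=
      hrel ▸ Ideal.mem_span_singleton_self _
    rw [mul_zero, Ideal.span_singleton_zero, Ideal.mem_bot, mul_eq_zero] at h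
    rcases h with h | h
    · exact (pow_ne_zero N (prime_C p).ne_zero) h
    · exact hG0 h
  refine mem_charIdeal_of_lengthAt_le hX hG0 fun 𝔭 h𝔭 => ?_
  by_cases hp𝔭 : PowerSeries.C (p : ℤ_[p]) ∈ 𝔭.asIdeal
  · exact hμ 𝔭 (ZetaImage.eq_augIdealP_of_height_eq_one_of_C_mem 𝔭 h𝔭 hp𝔭)
  calc lengthAt (IwasawaAlgebra p) X 𝔭
      ≤ lengthAt (IwasawaAlgebra p) (IwasawaAlgebra p ⧸ Ideal.span {g}) 𝔭 :=
        lengthAt_le_quotient_span_of_mem_charIdeal hX hg0 hg 𝔭 h𝔭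
    _ = lengthAt (IwasawaAlgebra p) (IwasawaAlgebra p ⧸ Ideal.span {PowerSeries.C (p : ℤ_[p]) ^ a * g}) 𝔭 :=
        (lengthAt_quotient_span_C_pow_mul_offP g a 𝔭 h𝔭 hp𝔭).symm
    _ = lengthAt (IwasawaAlgebra p) (IwasawaAlgebra p ⧸ Ideal.span {PowerSeries.C (p : ℤ_[p]) ^ N * G}) 𝔭 :=
        lengthAt_eq_of_linearEquiv (Submodule.quotEquivOfEq _ _ hrel) 𝔭
    _ = lengthAt (IwasawaAlgebra p) (IwasawaAlgebra p ⧸ Ideal.span {G}) 𝔭 :=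
        lengthAt_quotient_span_C_pow_mul_offP G N 𝔭 h𝔭 hp𝔭

/-- At `(p)`: `ℓ_(p)(Λ/(T · G)) = ℓ_(p)(Λ/(G))` (`T ∉ (p)`). [cite: Washington1997, §13.2] -/
theorem lengthAt_quotient_span_X_mul_augIdealP (G : IwasawaAlgebra p)
    (𝔭 : PrimeSpectrum (IwasawaAlgebra p)) (h𝔭 : 𝔭.asIdeal = augIdealP p) :
    lengthAt (IwasawaAlgebra p) (IwasawaAlgebra p ⧸ Ideal.span {(PowerSeries.X : IwasawaAlgebra p) * G}) 𝔭 =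
      lengthAt (IwasawaAlgebra p) (IwasawaAlgebra p ⧸ Ideal.span {G}) 𝔭 := by
  rw [lengthAt_quotient_span_singleton_mul G PowerSeries.X_ne_zero 𝔭,
    lengthAt_quotient_eq_zero_of_not_le (I := Ideal.span {(PowerSeries.X : IwasawaAlgebra p)})
      (by rw [h𝔭, Ideal.span_singleton_le_iff_mem]; exact ZetaImage.X_notMem_augIdealP), zero_add]

/-- A rational number `ϖ` satisfies `ϖ.num = p^e · b' · ϖ` in `ℚ` with `ϖ.den = p^e · b'`, `p ∤ b'`. [folklore] -/
theorem exists_num_eq_pow_mul_mul (ϖ : ℚ) :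
    ∃ (e b' : ℕ), ¬ p ∣ b' ∧ (ϖ.num : ℚ) = (p : ℚ) ^ e * (b' : ℚ) * ϖ := by
  obtain ⟨e, b', hb', hden⟩ :=
    Nat.exists_eq_pow_mul_and_not_dvd ϖ.den_nz p (Fact.out : p.Prime).ne_one
  refine ⟨e, b', hb', ?_⟩
  have h := Rat.mul_den_eq_num ϖ
  rw [hden] at h
  push_cast at h
  linear_combination -h

/-- A natural number prime to `p` gives a unit constant `C b'` of `Λ`. [folklore] -/
theorem isUnit_C_natCast_of_not_dvd {b : ℕ} (hb : ¬ p ∣ b) :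
    IsUnit (PowerSeries.C ((b : ℕ) : ℤ_[p]) : IwasawaAlgebra p) := by
  refine PowerSeries.isUnit_iff_constantCoeff.mpr ?_
  rw [PowerSeries.constantCoeff_C, PadicInt.isUnit_iff]
  refine le_antisymm (PadicInt.norm_le_one _) (not_lt.mp fun hlt ↦ hb ?_)
  have hdvd := (PadicInt.norm_int_lt_one_iff_dvd (p := p) (b : ℤ)).mp (by exact_mod_cast hlt)
  exact_mod_cast hdvd

/-- A nonzero integer `n` is `p^v · (unit)` in `ℤ_p`, so the ideals `(C n · x)` and `(p^v · x)` of `Λ` coincide. [folklore] -/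
theorem exists_span_C_intCast_mul_eq {n : ℤ} (hn : n ≠ 0) (x : IwasawaAlgebra p) :
    ∃ v : ℕ, Ideal.span {PowerSeries.C ((n : ℤ) : ℤ_[p]) * x} =
      Ideal.span {PowerSeries.C (p : ℤ_[p]) ^ v * x} := by
  have hn' : ((n : ℤ) : ℤ_[p]) ≠ 0 := by exact_mod_cast hn
  refine ⟨((n : ℤ) : ℤ_[p]).valuation, ?_⟩
  have hu : IsUnit (PowerSeries.C ((PadicInt.unitCoeff hn' : ℤ_[p]ˣ) : ℤ_[p]) : IwasawaAlgebra p) :=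
    (Units.isUnit _).map _
  conv_lhs => rw [PadicInt.unitCoeff_spec hn', map_mul, map_pow, mul_assoc]
  exact Ideal.span_singleton_mul_left_unit hu _

/-- `ι(C(num) · y) = ι(C(p)^(n+e) · (C(b') · G))` bookkeeping: from `ι y = C(p^n) · L`, `ι G = C(ϖ) · L` and
`ϖ.num = p^e · b' · ϖ` one gets `C(ϖ.num) · y = C(p)^(n+e) · (C(b') · G)` in `Λ`. [folklore] -/
theorem C_num_mul_eq_of_iota {n e b' : ℕ} {y G : IwasawaAlgebra p} {ϖ : ℚ} {L : PowerSeries ℚ_[p]}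
    (hι : iwasawaToPowerSeries p y = PowerSeries.C ((p : ℚ_[p]) ^ n) * L)
    (hG : iwasawaToPowerSeries p G = PowerSeries.C ((ϖ : ℚ) : ℚ_[p]) * L)
    (hnum : (ϖ.num : ℚ) = (p : ℚ) ^ e * (b' : ℚ) * ϖ) :
    PowerSeries.C ((ϖ.num : ℤ) : ℤ_[p]) * y =
      PowerSeries.C (p : ℤ_[p]) ^ (n + e) * (PowerSeries.C ((b' : ℕ) : ℤ_[p]) * G) := by
  have hcast : ((ϖ.num : ℤ) : ℚ_[p]) = (p : ℚ_[p]) ^ e * ((b' : ℕ) : ℚ_[p]) * ((ϖ : ℚ) : ℚ_[p]) := by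
    have h := congrArg (fun q : ℚ ↦ (q : ℚ_[p])) hnum
    push_cast at h
    exact h
  have hC : ∀ x : ℤ_[p], iwasawaToPowerSeries p (PowerSeries.C x) = PowerSeries.C (x : ℚ_[p]) :=
    fun x ↦ by rw [iwasawaToPowerSeries, PowerSeries.map_C]; rfl
  apply iwasawaToPowerSeries_injective p
  rw [map_mul, map_mul, map_mul, map_pow, hι, hG, hC, hC, hC, PadicInt.coe_intCast, PadicInt.coe_natCast,
    PadicInt.coe_natCast, hcast, map_mul, map_mul, map_pow, map_pow]
  ring

end Algebra

/-! ### §1b The two absorption shapes over a Selmer dual datum (non-split ∕ split multiplicative prime) -/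

section Shapes

variable {p : ℕ} [Fact p.Prime] {W : WeierstrassCurve ℚ} {κ : ZpExtension ℚ p}
  {γ : Field.absoluteGaloisGroup ℚ}

/-- **Non-split shape, rational period ratio absorbed, `μ`-INEQUALITY instead of `μ = 0`.**  `X` torsion and
finitely generated, `g ∈ char_Λ X` with `ι g = C(p^n) · L` (the prime-uniform Kato `⊗ℚ` shape), `ι G = C(ϖ) · L`
(`ϖ ∈ ℚ`; integrality of the Néron-normalised function) and `ℓ_(p)(X) ≤ ℓ_(p)(Λ/(G))` ⟹ `G ∈ char_Λ X`.
With `ϖ.num = p^e · b' · ϖ` (`p ∤ b'`): `C(ϖ.num) · g = C(p)^{n+e} · C(b') · G` in `Λ`, so the ideals `(p^v · g)` and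
`(p^{n+e} · G)` coincide and `mem_charIdeal_of_span_eq_of_lengthAt_le` applies. [cite: Washington1997, §13.2]
[cite: Kato2004Asterisque, Thm. 17.4 (2)–(3) (p. 273)] -/
theorem mem_charIdeal_of_katoRat_of_integral_of_lengthAt_le (D : W.SelmerDualData κ γ)
    [Module.Finite (IwasawaAlgebra p) D.X] (hX : D.IsTorsion)
    {n : ℕ} {g G : IwasawaAlgebra p} {ϖ : ℚ} {L : PowerSeries ℚ_[p]} (hg : g ∈ D.charIdeal)
    (hι : iwasawaToPowerSeries p g = PowerSeries.C ((p : ℚ_[p]) ^ n) * L)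
    (hG : iwasawaToPowerSeries p G = PowerSeries.C ((ϖ : ℚ) : ℚ_[p]) * L)
    (hμ : ∀ 𝔭 : PrimeSpectrum (IwasawaAlgebra p), 𝔭.asIdeal = augIdealP p →
      lengthAt (IwasawaAlgebra p) D.X 𝔭 ≤ lengthAt (IwasawaAlgebra p) (IwasawaAlgebra p ⧸ Ideal.span {G}) 𝔭) :
    G ∈ D.charIdeal := by
  by_cases hG0 : G = 0
  · rw [hG0]; exact zero_mem _
  have hϖ0 : ϖ ≠ 0 := by
    rintro rfl
    apply hG0
    apply iwasawaToPowerSeries_injective p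
    rw [hG, map_zero, Rat.cast_zero, map_zero, zero_mul]
  obtain ⟨e, b', hb', hnum⟩ := exists_num_eq_pow_mul_mul (p := p) ϖ
  have hΛ := C_num_mul_eq_of_iota hι hG hnum
  obtain ⟨v, hv⟩ := exists_span_C_intCast_mul_eq (p := p) (Rat.num_ne_zero.mpr hϖ0) g
  have hrel : Ideal.span {PowerSeries.C (p : ℤ_[p]) ^ v * g} =
      Ideal.span {PowerSeries.C (p : ℤ_[p]) ^ (n + e) * G} := by
    rw [← hv, hΛ, mul_left_comm]
    exact Ideal.span_singleton_mul_left_unit (isUnit_C_natCast_of_not_dvd hb') _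
  exact mem_charIdeal_of_span_eq_of_lengthAt_le hX hg hrel hμ

/-- **Split shape** (the exceptional zero charged to the local cohomology: `ι(T · g) = C(p^n) · L`, `ι G = C(ϖ) · L`):
under the same `μ`-inequality for `G`, `G = T · G'` with `G' ∈ char_Λ X`, i.e. `ι(T · G') = C(ϖ) · L`.  Constant
coefficients of `C(ϖ.num) · T · g = C(p)^{n+e} · C(b') · G` give `G(0) = 0` in the domain `ℤ_p`; cancel `T` and
absorb as in the non-split shape, `ℓ_(p)(Λ/(T · G')) = ℓ_(p)(Λ/(G'))`. [cite: Washington1997, §13.2]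
[cite: Kato2004Asterisque, Thm. 17.4 (2)–(3) (p. 273)] [cite: Kobayashi2006DocMath, Thm. 4.1 (the split shape)] -/
theorem exists_mem_charIdeal_of_katoRat_of_integral_of_lengthAt_le_split (D : W.SelmerDualData κ γ)
    [Module.Finite (IwasawaAlgebra p) D.X] (hX : D.IsTorsion)
    {n : ℕ} {g G : IwasawaAlgebra p} {ϖ : ℚ} {L : PowerSeries ℚ_[p]} (hg : g ∈ D.charIdeal)
    (hι : iwasawaToPowerSeries p (PowerSeries.X * g) = PowerSeries.C ((p : ℚ_[p]) ^ n) * L)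
    (hG : iwasawaToPowerSeries p G = PowerSeries.C ((ϖ : ℚ) : ℚ_[p]) * L)
    (hμ : ∀ 𝔭 : PrimeSpectrum (IwasawaAlgebra p), 𝔭.asIdeal = augIdealP p →
      lengthAt (IwasawaAlgebra p) D.X 𝔭 ≤ lengthAt (IwasawaAlgebra p) (IwasawaAlgebra p ⧸ Ideal.span {G}) 𝔭) :
    ∃ G' ∈ D.charIdeal,
      iwasawaToPowerSeries p (PowerSeries.X * G') = PowerSeries.C ((ϖ : ℚ) : ℚ_[p]) * L := by
  by_cases hG0 : G = 0
  · refine ⟨0, zero_mem _, ?_⟩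
    rw [mul_zero, map_zero, ← hG, hG0, map_zero]
  have hϖ0 : ϖ ≠ 0 := by
    rintro rfl
    apply hG0
    apply iwasawaToPowerSeries_injective p
    rw [hG, map_zero, Rat.cast_zero, map_zero, zero_mul]
  obtain ⟨e, b', hb', hnum⟩ := exists_num_eq_pow_mul_mul (p := p) ϖ
  have hΛ := C_num_mul_eq_of_iota hι hG hnum
  -- constant coefficients: `G(0) = 0`
  have h0 : PowerSeries.constantCoeff G = 0 := by
    have h := congrArg PowerSeries.constantCoeff hΛ
    simp only [map_mul, map_pow, PowerSeries.constantCoeff_X, PowerSeries.constantCoeff_C, mul_zero,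
      zero_mul] at h
    have hpt : ((p : ℤ_[p]) ^ (n + e)) ≠ 0 := pow_ne_zero _ PadicInt.prime_p.ne_zero
    have hb0 : ((b' : ℕ) : ℤ_[p]) ≠ 0 := by
      intro hb0
      have : (b' : ℕ) = 0 := by exact_mod_cast hb0
      exact hb' (this ▸ dvd_zero p)
    rcases mul_eq_zero.mp h.symm with h1 | h2
    · exact absurd h1 hpt
    · rcases mul_eq_zero.mp h2 with h3 | h4
      · exact absurd h3 hb0
      · exact h4
  obtain ⟨G', rfl⟩ := PowerSeries.X_dvd_iff.mpr h0
  refine ⟨G', ?_, hG⟩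
  have hΛ' : PowerSeries.C ((ϖ.num : ℤ) : ℤ_[p]) * g =
      PowerSeries.C (p : ℤ_[p]) ^ (n + e) * (PowerSeries.C ((b' : ℕ) : ℤ_[p]) * G') := by
    apply mul_left_cancel₀ (PowerSeries.X_ne_zero (R := ℤ_[p]))
    calc (PowerSeries.X : IwasawaAlgebra p) * (PowerSeries.C ((ϖ.num : ℤ) : ℤ_[p]) * g)
        = PowerSeries.C ((ϖ.num : ℤ) : ℤ_[p]) * (PowerSeries.X * g) := by ring
      _ = PowerSeries.C (p : ℤ_[p]) ^ (n + e) * (PowerSeries.C ((b' : ℕ) : ℤ_[p]) * (PowerSeries.X * G')) := hΛ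
      _ = PowerSeries.X * (PowerSeries.C (p : ℤ_[p]) ^ (n + e) * (PowerSeries.C ((b' : ℕ) : ℤ_[p]) * G')) := by
          ring
  obtain ⟨v, hv⟩ := exists_span_C_intCast_mul_eq (p := p) (Rat.num_ne_zero.mpr hϖ0) g
  have hrel : Ideal.span {PowerSeries.C (p : ℤ_[p]) ^ v * g} =
      Ideal.span {PowerSeries.C (p : ℤ_[p]) ^ (n + e) * G'} := by
    rw [← hv, hΛ', mul_left_comm]
    exact Ideal.span_singleton_mul_left_unit (isUnit_C_natCast_of_not_dvd hb') _
  refine mem_charIdeal_of_span_eq_of_lengthAt_le hX hg hrel fun 𝔭 h𝔭 => ?_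
  rw [← lengthAt_quotient_span_X_mul_augIdealP G' 𝔭 h𝔭]
  exact hμ 𝔭 h𝔭

end Shapes

end Summit.BirchSwinnertonDyer.Rank1Residual.X11b.FineMuTransfer

end
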